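import Mathlib
import HarnessLib

/-!
# The Möbius preimage identity for dilation sums (handoff prove-1 gen12, for idea-1 g21's hand-off H1a)

A finite, RH-free algebraic identity used by the prolate line of the HANDOFF track (IDEAS-prolate §99.3,
§104.2, §107.7(b)): with `(E f)(u) = u^{1/2} Σ_{n ≤ λ/u} f(nu)` and
`(M g)(y) = y^{-1/2} Σ_{m ≤ λ/y} μ(m) m^{-1/2} g(my)` one has `E (M g) = g` on `(0, λ]` for every `g`
vanishing off `(0, λ]`.  Both operators are finite sums, and the composition is the double sum
`Σ_n Σ_m μ(m) (nm)^{-1/2} g(nmu)`; grouping by `k = nm` and `Σ_{d ∣ k} μ(d) = [k = 1]`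
(`ArithmeticFunction.moebius_mul_coe_zeta`) gives `g(u)`.  We prove the ARITHMETIC CORE in the form
that needs no real analysis: for any `G : ℕ → R` vanishing above a cutoff `N`,
`Σ_{n=1}^{N} Σ_{m=1}^{N} μ(m) • G(nm) = G(1)` (`sum_sum_moebius_smul_mul_eq`), and then the dilation
form with the weights `(nm)^{-1/2}` and a function `g : ℝ → ℂ` vanishing on `(λ, ∞)`
(`moebius_preimage_identity`).  Nothing here bears on the truth of RH. [folklore]
-/

set_option linter.dupNamespace false  -- the mandated namespace repeats `RiemannHypothesis`

open Finset ArithmeticFunction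

namespace Summit.RiemannHypothesis.RiemannHypothesis.Theorems

/-- `Σ_{d ∣ k} μ(d) = [k = 1]` as a sum over the divisor antidiagonal. [folklore] -/
theorem sum_divisorsAntidiagonal_moebius (k : ℕ) :
    ∑ p ∈ k.divisorsAntidiagonal, (moebius p.1 : ℤ) = if k = 1 then 1 else 0 := by
  have h := congrArg (fun f : ArithmeticFunction ℤ => f k) moebius_mul_coe_zeta
  simp only [mul_apply, one_apply, natCoe_apply] at h
  rw [← h]
  refine sum_congr rfl fun p hp ↦ ?_
  have hp2 : p.2 ≠ 0 := by
    intro h0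
    have := Nat.mem_divisorsAntidiagonal.1 hp
    rw [h0, mul_zero] at this
    exact this.2 this.1.symm
  rw [zeta_apply_ne hp2, Nat.cast_one, mul_one]

/-- **Finite Möbius inversion over multiples (arithmetic core).** If `G : ℕ → R` vanishes above `N`,
then `Σ_{n=1}^{N} Σ_{m=1}^{N} μ(m) • G(n·m) = G(1)` (for `N ≥ 1`; both sides read `G 1`). [folklore] -/
theorem sum_sum_moebius_smul_mul_eq {R : Type*} [AddCommGroup R] (G : ℕ → R) {N : ℕ} (hN : 1 ≤ N)
    (hG : ∀ k, N < k → G k = 0) :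
    ∑ n ∈ Icc 1 N, ∑ m ∈ Icc 1 N, (moebius m : ℤ) • G (n * m) = G 1 := by
  classical
  -- Step 1: the double sum over the square equals the sum over pairs with product ≤ N
  -- (the other pairs contribute `G(nm) = 0`).
  set P : Finset (ℕ × ℕ) := (Icc 1 N ×ˢ Icc 1 N).filter (fun p => p.1 * p.2 ≤ N) with hP
  have h1 : ∑ n ∈ Icc 1 N, ∑ m ∈ Icc 1 N, (moebius m : ℤ) • G (n * m) =
      ∑ p ∈ P, (moebius p.2 : ℤ) • G (p.1 * p.2) := by
    rw [← sum_product (s := Icc 1 N) (t := Icc 1 N) (f := fun p : ℕ × ℕ => (moebius p.2 : ℤ) • G (p.1 * p.2)),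
      hP, sum_filter]
    refine sum_congr rfl fun p _ ↦ ?_
    split_ifs with h
    · rfl
    · rw [hG _ (lt_of_not_ge h), smul_zero]
  -- Step 2: `P` is the disjoint union over `k ≤ N` of the divisor antidiagonals (with coordinates swapped:
  -- antidiagonal pairs are `(d, k/d)`; we sum `μ` of the SECOND factor, so use the pair `(n, m) = (k/d·?, ?)`).
  -- We map `p = (n, m) ∈ P` to `k = n*m` and identify the fibre with `k.divisorsAntidiagonal` via `(n, m) ↦ (m, n)`.
  have h2 : ∑ p ∈ P, (moebius p.2 : ℤ) • G (p.1 * p.2) =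
      ∑ k ∈ Icc 1 N, ∑ q ∈ k.divisorsAntidiagonal, (moebius q.1 : ℤ) • G k := by
    rw [sum_sigma' (Icc 1 N) (fun k => k.divisorsAntidiagonal) (fun k q => (moebius q.1 : ℤ) • G k)]
    refine sum_bij (fun p _ => ⟨p.1 * p.2, (p.2, p.1)⟩) ?_ ?_ ?_ ?_
    · intro p hp
      rw [hP, mem_filter, mem_product, mem_Icc, mem_Icc] at hp
      obtain ⟨⟨⟨h1n, -⟩, ⟨h1m, -⟩⟩, hle⟩ := hp
      rw [mem_sigma, mem_Icc, Nat.mem_divisorsAntidiagonal]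
      refine ⟨⟨Nat.one_le_iff_ne_zero.2 (Nat.mul_ne_zero (by omega) (by omega)), hle⟩, by ring,
        Nat.mul_ne_zero (by omega) (by omega)⟩
    · intro p hp p' hp' heq
      simp only [Sigma.mk.injEq] at heq
      obtain ⟨-, h⟩ := heq
      rw [heq_iff_eq, Prod.mk.injEq] at h
      exact Prod.ext h.2 h.1
    · intro kq hkq
      rw [mem_sigma, mem_Icc, Nat.mem_divisorsAntidiagonal] at hkq
      obtain ⟨⟨hk1, hkN⟩, hmul, hk0⟩ := hkq
      refine ⟨(kq.2.2, kq.2.1), ?_, ?_⟩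
      · rw [hP, mem_filter, mem_product, mem_Icc, mem_Icc]
        have ha : kq.2.1 ≠ 0 := by intro h; rw [h, zero_mul] at hmul; exact hk0 hmul.symm
        have hb : kq.2.2 ≠ 0 := by intro h; rw [h, mul_zero] at hmul; exact hk0 hmul.symm
        have hle1 : kq.2.2 ≤ N := by
          calc kq.2.2 ≤ kq.2.1 * kq.2.2 := Nat.le_mul_of_pos_left _ (Nat.pos_of_ne_zero ha)
            _ = kq.1 := hmul
            _ ≤ N := hkN
        have hle2 : kq.2.1 ≤ N := by
          calc kq.2.1 ≤ kq.2.1 * kq.2.2 := Nat.le_mul_of_pos_right _ (Nat.pos_of_ne_zero hb)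
            _ = kq.1 := hmul
            _ ≤ N := hkN
        refine ⟨⟨⟨Nat.one_le_iff_ne_zero.2 hb, hle1⟩, ⟨Nat.one_le_iff_ne_zero.2 ha, hle2⟩⟩, ?_⟩
        calc kq.2.2 * kq.2.1 = kq.2.1 * kq.2.2 := mul_comm _ _
          _ = kq.1 := hmul
          _ ≤ N := hkN
      · obtain ⟨k, ⟨a, b⟩⟩ := kq
        simp only at hmul ⊢
        subst hmul
        simp [mul_comm]
    · intro p hp
      simp only
  -- Step 3: the inner sum is `[k = 1]`.
  rw [h1, h2]
  have h3 : ∀ k ∈ Icc 1 N, ∑ q ∈ k.divisorsAntidiagonal, (moebius q.1 : ℤ) • G k =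
      (if k = 1 then (1 : ℤ) else 0) • G k := by
    intro k _
    rw [← sum_smul, sum_divisorsAntidiagonal_moebius]
  rw [sum_congr rfl h3, Finset.sum_eq_single 1]
  · simp
  · intro b _ hb; simp [hb]
  · intro h; exact absurd (mem_Icc.2 ⟨le_rfl, hN⟩) h

/-- **Möbius preimage identity, dilation form (H1a of handoff idea-1 g21).** For `u > 0`, a cutoff
`N ≥ λ/u` (`N ≥ 1`) and `g : ℝ → ℂ` vanishing on `(λ, ∞)`:
`Σ_{n=1}^{N} Σ_{m=1}^{N} μ(m) (nm)^{-1/2} g(n m u) = g(u)` — i.e. `E(M g)(u) = g(u)` with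
`E f(u) = u^{1/2} Σ_n f(nu)`, `M g(y) = y^{-1/2} Σ_m μ(m) m^{-1/2} g(my)` (all sums finite). [folklore] -/
theorem moebius_preimage_identity (g : ℝ → ℂ) {lam u : ℝ} (hu : 0 < u) {N : ℕ} (hN : 1 ≤ N)
    (hNu : lam / u ≤ N) (hg : ∀ x : ℝ, lam < x → g x = 0) :
    ∑ n ∈ Icc 1 N, ∑ m ∈ Icc 1 N,
        (moebius m : ℂ) * Complex.ofReal (((n * m : ℕ) : ℝ) ^ (-(1 / 2 : ℝ))) * g ((n * m : ℕ) * u) =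
      g u := by
  set G : ℕ → ℂ := fun k => Complex.ofReal (((k : ℕ) : ℝ) ^ (-(1 / 2 : ℝ))) * g ((k : ℕ) * u)
    with hGdef
  have hG : ∀ k, N < k → G k = 0 := by
    intro k hk
    have hx : lam < (k : ℝ) * u := by
      have hk' : (N : ℝ) < k := by exact_mod_cast hk
      have : lam ≤ (N : ℝ) * u := by rwa [div_le_iff₀ hu] at hNu
      nlinarith
    simp [hGdef, hg _ hx]
  have key := sum_sum_moebius_smul_mul_eq G hN hG
  have hG1 : G 1 = g u := by simp [hGdef]
  rw [hG1] at key
  rw [← key]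
  refine sum_congr rfl fun n _ ↦ sum_congr rfl fun m _ ↦ ?_
  rw [hGdef, zsmul_eq_mul]
  push_cast
  ring

end Summit.RiemannHypothesis.RiemannHypothesis.Theorems
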